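import Summits.QuantumFields.YangMills.Theorems.BalabanUVNodesPortS1Series

/-!
# K0⁷ — EDITION 13b: the SERIES of integer-local formula objects is ONE object — `IntLocalFormula.tsum` (porter PT-A-1 g3's ask)

DEFINER seat `ym-nodeO-def-1` (gen 34), on porter PT-A-1 g3 (nodeO STATUS 2026-08-31T01:19:13Z ∕ 01:30:05Z): the (R4) pieces `Ψ_LZ` ([16] (63) regrouped walk series) and `Ψ_FE`
([II] (2.13) polymer series) are SERIES of window-local `SL(2,ℂ)`-invariant integer formulas; window-locality and invariance pass to `∑'` termwise and UNCONDITIONALLY (porter's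
`…PortS1Series.isLocal_tsum ∕ isGaugeInv_tsum`, `tsum_congr`), so the series of a family `ι → IntLocalFormula s` is again an `IntLocalFormula s` — this one-line constructor; convergence
matters only for the receipts (a)(b), which the porter's `analyticOnUc_of_summable ∕ bound118OnUc_of_hasSum` (Weierstrass M-test) supply.  `--kind definition --supports stmt-QuantumFields-20541
--as helper`; count-neutral.

HONEST FRAMING.  A definition (no content of Bałaban's); the residue of 27930⁸ is NOT proved; K0⁷ OPEN; NODE O 0∕1; COUNT 8∕28 · K 1∕4 UNMOVED; finite 𝕋⁴ at fixed ε — NOT continuum ∕ OS ∕ Clay;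
the Yang–Mills mass gap is NOT proved by any of this.  No `sorry`, `instance`, `notation`.
-/

noncomputable section

open scoped BigOperators

namespace Summit.QuantumFields.YangMills.Theorems.K0RecordFormatNames

/-- **The SERIES of a family of integer-local formula objects is one** (`Ψ X̂ f := ∑' i, (T i).Ψ X̂ f`; (LOC) and (GI) termwise by `tsum_congr`, no convergence needed —
porter PT-A-1's `…PortS1Series.isLocal_tsum ∕ isGaugeInv_tsum`). [cite: Balaban1988RG2Cluster, (2.13) p.14; Balaban1987RG1, (1.7) p.261, (1.19) p.263] -/
def IntLocalFormula.tsum {ι : Type*} {s : ℕ} (T : ι → IntLocalFormula s) : IntLocalFormula s where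
  Ψ := fun Xh f => ∑' i, (T i).Ψ Xh f
  isLocal := BalabanUVNodesPortS1.isLocal_tsum s (fun i => (T i).Ψ) fun i => (T i).isLocal
  isGaugeInv := BalabanUVNodesPortS1.isGaugeInv_tsum (fun i => (T i).Ψ) fun i => (T i).isGaugeInv

/-- The formula of the series (`rfl`). [cite: Balaban1988RG2Cluster, (2.13) p.14 (bookkeeping)] -/
theorem IntLocalFormula.tsum_Ψ {ι : Type*} {s : ℕ} (T : ι → IntLocalFormula s) (Xh : Finset (Fin 4 → ℤ)) (f : IntBondCfg) :
    (IntLocalFormula.tsum T).Ψ Xh f = ∑' i, (T i).Ψ Xh f := rfl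

end Summit.QuantumFields.YangMills.Theorems.K0RecordFormatNames

end
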